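import Summits.Parity.GeneralizedHardyLittlewood.Theorems.LeeYangFibresRelativeDimOneMoebiusSplitStubDefs
import Summits.Parity.GeneralizedHardyLittlewood.Theorems.LeeYangFibresRelativeDimOneMoebiusSplitTermBoundAux3
import Summits.Parity.GeneralizedHardyLittlewood.Theorems.LeeYangFibresRelativeDimOneMoebiusSplitMoebiusTermBVAux7
import Literature.NumberTheory.Sieve.LinearEquationsInPrimesDimOne
import Mathlib
import HarnessLib

/-!
# Route `LeeYangFibres`, crux `RelativeDimOne` (stmt-Parity-14113), line `single-moebius-split`,
# stub `stub_termClassSums` — auxiliary file 2: the dilated system of one class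

Along the progression `n = n₀ + M₀ m` of one class of the single-Möbius class sum `Σ(d, e)`, the
forms `ψ_i` become the DILATED forms `φ_u(m)` with `c_u φ_u(m) = ψ_{π(u)}(n₀ + M₀ m)` (`c_0 = e`,
`π(0) = j`; `c_u = 1`, `π(u) < j` otherwise). This file supplies what the atom `HybridOneMoebius`
and the singular-series bound `termBound_aux_singularProduct_le` ask of such a system:

* `tcs_nondegenerate_transport` — non-degeneracy is inherited from `Ψ` along any such transport
  (`π` injective, `c_u ≠ 0`, `M₀ ≠ 0`); `tcs_nondegenerate_tail` — and by the prime forms `(φ_u)_{u ≥ 1}`;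
* `tcs_coeffMinorProd_le`, `tcs_singularProduct_le` — if all coefficients and minors of a
  non-degenerate system of `s` forms are at most `N⁴` (`N ≥ 3`), then `𝔖 ≤ (2e⁵ (4s² + 9) log N)^s`;
* `tcs_termClassSum_eq_zero` — the class sum vanishes once `R_j e > 2LN` (no `n ∈ [-N, N]` has
  `ψ_j(n) > R_j e`).
-/

noncomputable section

open scoped BigOperators Classical
open Finset Literature.NumberTheory.Sieve

namespace Summit.Parity.GeneralizedHardyLittlewood.Cruxes.RelativeDimOne.SingleMoebiusSplit

/-! ### Non-degeneracy along a progression -/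

/-- **Transport of non-degeneracy.** Let `Ψ` be a non-degenerate `d = 1` system and let the forms
`φ_u` satisfy `c_u φ_u(m) = ψ_{π(u)}(n₀ + M m)` for all `m ∈ ℤ`, with `π` injective, `c_u ≠ 0` and
`M ≠ 0`. Then `Φ` is non-degenerate: a vanishing coefficient would make `ψ_{π(u)}` take the same
value at `n₀` and `n₀ + M`; a relation `α φ_u = β φ_v` gives `α c_v ψ_{π u} = β c_u ψ_{π v}` along the
progression, hence (two affine functions agreeing in slope and at one point) everywhere. -/
theorem tcs_nondegenerate_transport {s t : ℕ} {Ψ : Fin t → AffLinForm 1}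
    (hΨ : IsNondegenerateSystem Ψ) (Φ : Fin s → AffLinForm 1) (π : Fin s → Fin t)
    (hπ : Function.Injective π) (c : Fin s → ℤ) (hc : ∀ u, c u ≠ 0) (n₀ M : ℤ) (hM : M ≠ 0)
    (h : ∀ (u) (m : ℤ), c u * (Φ u).eval (fun _ => m) = (Ψ (π u)).eval (fun _ => n₀ + M * m)) :
    IsNondegenerateSystem Φ := by
  have hev : ∀ (ψ : AffLinForm 1) (n : Fin 1 → ℤ), ψ.eval n = ψ.coeff 0 * n 0 + ψ.const :=
    fun ψ n => DimOne.eval_eq ψ n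
  constructor
  · intro u hzero
    have h0 := h u 0
    have h1 := h u 1
    rw [hev, hev] at h0 h1
    have hcoeff : (Φ u).coeff 0 = 0 := by rw [hzero]; rfl
    rw [hcoeff] at h0 h1
    simp only [zero_add, mul_zero, add_zero, mul_one] at h0 h1
    have hMa : (Ψ (π u)).coeff 0 * M = 0 := by linear_combination h0 - h1
    rcases mul_eq_zero.mp hMa with ha | ha
    · exact coeff_zero_ne_zero hΨ (π u) ha
    · exact hM ha
  · intro u v huv α β hαβ
    -- along the progression
    have hprog : ∀ m : ℤ, α * c v * (Ψ (π u)).eval (fun _ => n₀ + M * m) =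
        β * c u * (Ψ (π v)).eval (fun _ => n₀ + M * m) := by
      intro m
      rw [← h u m, ← h v m]
      have := hαβ (fun _ => m)
      linear_combination (c u * c v) * this
    -- slope and value at `n₀`
    have h0 := hprog 0
    have h1 := hprog 1
    simp only [hev, mul_zero, add_zero, mul_one] at h0 h1
    have hslope : α * c v * (Ψ (π u)).coeff 0 = β * c u * (Ψ (π v)).coeff 0 := by
      have h2 : α * c v * (Ψ (π u)).coeff 0 * M = β * c u * (Ψ (π v)).coeff 0 * M := by
        linear_combination h1 - h0
      exact mul_right_cancel₀ hM h2
    -- everywhere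
    have hall : ∀ n : Fin 1 → ℤ, α * c v * (Ψ (π u)).eval n = β * c u * (Ψ (π v)).eval n := by
      intro n
      rw [hev, hev]
      linear_combination (n 0 - n₀) * hslope + h0
    obtain ⟨hα, hβ⟩ := hΨ.2 (π u) (π v) (fun heq => huv (hπ heq)) _ _ hall
    exact ⟨(mul_eq_zero.mp hα).resolve_right (hc v), (mul_eq_zero.mp hβ).resolve_right (hc u)⟩

/-- The prime forms `(φ_{u+1})_{u < s}` of a non-degenerate `(φ₀; φ₁, …, φ_s)` are non-degenerate. -/
theorem tcs_nondegenerate_tail {s : ℕ} {Φ : Fin (s + 1) → AffLinForm 1}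
    (hΦ : IsNondegenerateSystem Φ) : IsNondegenerateSystem (fun i : Fin s => Φ i.succ) :=
  ⟨fun i => hΦ.1 i.succ, fun i k hik a b h => hΦ.2 i.succ k.succ
    (fun heq => hik (Fin.succ_injective _ heq)) a b h⟩

/-! ### The singular series of a polynomially dilated system -/

/-- If every coefficient and every minor of `Φ` is at most `Q` in absolute value, the product of
all of them is at most `Q^{s²}` (`s` coefficients and `s² − s` minors). -/
theorem tcs_coeffMinorProd_le {s : ℕ} (Φ : Fin s → AffLinForm 1) (Q : ℕ)
    (hc : ∀ i, ((Φ i).coeff 0).natAbs ≤ Q)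
    (hm : ∀ i k, ((Φ i).coeff 0 * (Φ k).const - (Φ k).coeff 0 * (Φ i).const).natAbs ≤ Q) :
    (∏ i, ((Φ i).coeff 0).natAbs) * ∏ ik ∈ (Finset.univ : Finset (Fin s)).offDiag,
        ((Φ ik.1).coeff 0 * (Φ ik.2).const - (Φ ik.2).coeff 0 * (Φ ik.1).const).natAbs ≤
      Q ^ (s * s) := by
  have h1 : ∏ i, ((Φ i).coeff 0).natAbs ≤ Q ^ s := by
    calc ∏ i, ((Φ i).coeff 0).natAbs ≤ Q ^ (Finset.univ : Finset (Fin s)).card :=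
          Finset.prod_le_pow_card _ _ _ fun i _ => hc i
      _ = Q ^ s := by rw [Finset.card_univ, Fintype.card_fin]
  have h2 : ∏ ik ∈ (Finset.univ : Finset (Fin s)).offDiag,
      ((Φ ik.1).coeff 0 * (Φ ik.2).const - (Φ ik.2).coeff 0 * (Φ ik.1).const).natAbs ≤
        Q ^ (s * s - s) := by
    calc _ ≤ Q ^ ((Finset.univ : Finset (Fin s)).offDiag).card :=
          Finset.prod_le_pow_card _ _ _ fun ik _ => hm ik.1 ik.2
      _ = Q ^ (s * s - s) := by rw [Finset.offDiag_card, Finset.card_univ, Fintype.card_fin]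
  calc _ ≤ Q ^ s * Q ^ (s * s - s) := Nat.mul_le_mul h1 h2
    _ = Q ^ (s * s) := by
        rw [← pow_add]
        congr 1
        have : s ≤ s * s := Nat.le_mul_self s
        omega

/-- **`𝔖 ≤ (2e⁵ (4s² + 9) log N)^s`** for a non-degenerate `d = 1` system of `s` forms whose
coefficients and minors are at most `N⁴` in absolute value (`N ≥ 3`): the product of coefficients and
minors is `≤ N^{4s²}`, and `log(3⁹ N^{4s²}) ≤ (4s² + 9) log N` in `termBound_aux_singularProduct_le`. -/
theorem tcs_singularProduct_le : ∀ (s : ℕ) (Φ : Fin s → AffLinForm 1), IsNondegenerateSystem Φ →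
    ∀ (N : ℕ), 3 ≤ N → (∀ i, ((Φ i).coeff 0).natAbs ≤ N ^ 4) →
    (∀ i k, ((Φ i).coeff 0 * (Φ k).const - (Φ k).coeff 0 * (Φ i).const).natAbs ≤ N ^ 4) →
    singularProduct Φ ≤ (2 * Real.exp 5 * ((4 * s * s + 9) * Real.log N)) ^ s := by
  intro s Φ hΦ N hN hc hm
  have hprod := tcs_coeffMinorProd_le Φ (N ^ 4) hc hm
  have hX : (((∏ i, ((Φ i).coeff 0).natAbs) * ∏ ik ∈ (Finset.univ : Finset (Fin s)).offDiag,
      ((Φ ik.1).coeff 0 * (Φ ik.2).const - (Φ ik.2).coeff 0 * (Φ ik.1).const).natAbs : ℕ) : ℝ) ≤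
        (((N ^ 4) ^ (s * s) : ℕ) : ℝ) := by exact_mod_cast hprod
  have h𝔖 := termBound_aux_singularProduct_le s Φ hΦ _ hX
  have hN0 : (0 : ℝ) < N := by exact_mod_cast (show 0 < N by omega)
  have hN3 : (3 : ℝ) ≤ N := by exact_mod_cast hN
  have hlogN : 0 ≤ Real.log N := Real.log_nonneg (by linarith)
  have hlog3 : Real.log 3 ≤ Real.log N := Real.log_le_log (by norm_num) hN3
  have hXpos : (0 : ℝ) < (((N ^ 4) ^ (s * s) : ℕ) : ℝ) := by positivity
  have hlog : Real.log (3 ^ 9 * (((N ^ 4) ^ (s * s) : ℕ) : ℝ)) ≤ (4 * s * s + 9) * Real.log N := by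
    rw [Real.log_mul (by positivity) hXpos.ne', Real.log_pow]
    push_cast
    rw [← pow_mul, Real.log_pow]
    push_cast
    nlinarith
  have hbase : 0 ≤ 2 * Real.exp 5 * Real.log (3 ^ 9 * (((N ^ 4) ^ (s * s) : ℕ) : ℝ)) := by
    refine mul_nonneg (by positivity) (Real.log_nonneg ?_)
    have h1 : (1 : ℝ) ≤ (((N ^ 4) ^ (s * s) : ℕ) : ℝ) := by
      exact_mod_cast Nat.one_le_pow _ _ (by positivity)
    nlinarith
  exact h𝔖.trans (pow_le_pow_left₀ hbase (mul_le_mul_of_nonneg_left hlog (by positivity)) s)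

/-! ### Trivial vanishing of the class sum -/

/-- For `‖Ψ‖_N ≤ L` (`N ≥ 1`) every value `ψ_j(n)`, `n ∈ [-N, N]`, is at most `2LN`; so the class sum
`Σ(d, e)`, which only sees `n` with `ψ_j(n) > R_j e`, vanishes once `R_j e ≥ 2LN`. -/
theorem tcs_termClassSum_eq_zero {k : ℕ} (Ψ : Fin (k + 1) → AffLinForm 1) (K : Set (Fin 1 → ℝ))
    {N L : ℕ} (hN : 1 ≤ N) (hsize : affLinSize Ψ N ≤ L) (Rj : ℝ) (j : Fin (k + 1))
    (d : Fin (k + 1) → ℕ) {e : ℕ} (he : 2 * (L : ℝ) * N ≤ Rj * e) :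
    termClassSum Ψ K N Rj j d e = 0 := by
  unfold termClassSum
  refine Finset.sum_eq_zero fun n hn => ?_
  exfalso
  rw [Finset.mem_filter, Finset.mem_Icc] at hn
  obtain ⟨⟨hnl, hnu⟩, -, -, -, -, hlt⟩ := hn
  have hsz := natAbs_le_of_affLinSize_le hN hsize j
  have hab : |(Ψ j).coeff 0| ≤ L := by
    rw [← Int.natCast_natAbs]; exact_mod_cast hsz.1
  have hbb : |(Ψ j).const| ≤ L * N := by
    rw [← Int.natCast_natAbs]; exact_mod_cast hsz.2
  have hnn : |n| ≤ N := abs_le.mpr ⟨hnl, hnu⟩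
  have hZ : (Ψ j).eval (fun _ => n) ≤ 2 * L * N := by
    rw [DimOne.eval_eq]
    calc (Ψ j).coeff 0 * n + (Ψ j).const ≤ |(Ψ j).coeff 0 * n + (Ψ j).const| := le_abs_self _
      _ ≤ |(Ψ j).coeff 0| * |n| + |(Ψ j).const| := by rw [← abs_mul]; exact abs_add_le _ _
      _ ≤ L * N + L * N := add_le_add (mul_le_mul hab hnn (abs_nonneg _) (by positivity)) hbb
      _ = 2 * L * N := by ring
  have hR : (((Ψ j).eval (fun _ => n) : ℤ) : ℝ) ≤ 2 * L * N := by exact_mod_cast hZ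
  linarith

end Summit.Parity.GeneralizedHardyLittlewood.Cruxes.RelativeDimOne.SingleMoebiusSplit
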